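/-
Copyright (c) 2026. All rights reserved.
Released under Apache 2.0 license as described in the file LICENSE.
Authors: abc-iut cell, wave-4 seat abc-iut-w4-d085 (L3 sub-DAG Thm 5.4, coordinator: the (iii) umbrella junction).
-/
import Literature.AnabelianGeometry.SemiGraphs.ArithThm54iiiAssembly
import Literature.AnabelianGeometry.SemiGraphs.ArithQuasiGeometricSurjective
import Literature.AnabelianGeometry.SemiGraphs.ArithQuasiGeometricSurjectiveOfSlim
import Literature.AnabelianGeometry.SemiGraphs.ArithQuasiGeometricInjective
import Literature.AnabelianGeometry.SemiGraphs.ArithQuasiGeometricHvOfIota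
import Literature.AnabelianGeometry.SemiGraphs.ArithQuasiGeometricSurjectiveCompat
import Literature.AnabelianGeometry.SemiGraphs.ArithQuasiGeometricCompat
import HarnessLib

/-!
# [SemiAnbd] Theorem 5.4 (iii): the umbrella junction (rows T54-5, T54-6, T54-7 composed)

Mochizuki, *Semi-graphs of anabelioids*, Publ. RIMS **42** (2006), §5, Theorem 5.4 (iii) p. 66
[cite: MochizukiSemiAnbd2006, Thm 5.4 (iii), p. 66]: "Applying `B^temp(−)` determines a natural bijective
correspondence between locally open morphisms of arithmetic semi-graphs of anabelioids `𝔊 → ℍ` [over `A`]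
and arithmetically quasi-geometric continuous homomorphisms `Π^temp_𝔊 → Π^temp_ℍ` [over `A`, up to inner
automorphism]". PROOF-ONLY (no definition): the typed statement `ArithQuasiGeometricCorrespondenceStatement
𝔊 ℍ e augG augH btemp` (abc-iut-L3-t3, `ArithmeticCoverings.lean`) from the sub-DAG rows
(HOME/plan/L3/SUBDAG-SemiAnbd-Thm54.md): the coordinator assembly `arithQuasiGeometricCorrespondenceStatement_of_rows`
(`ArithThm54iiiAssembly.lean`: clause 1 = Thm 5.4 (ii) + Rmk 5.3.1 on both sides + the geometric openness
data of `B^temp(φ)`, rows T54-5 (abc-iut-w4-d106) / W4-18; clause 2 = the injectivity residual `hinj`, row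
T54-6 (abc-iut-w4-d082)) with its clause-3 binder `h3` DISCHARGED BY NAME by row T54-7 (abc-iut-w5-d141,
`Thm54iii.clause3_of_geometric`, `ArithQuasiGeometricSurjective.lean`: the arithmetic translation of
Cor 3.9 (b) — every arithmetically quasi-geometric `f` over `A` is `B^temp(φ)` up to inner automorphism,
from the geometric Cor 3.9 (b) at the kernels `hCor39`, the Prop 5.2 (iv) dictionary `hιG` / `hιH` /
`hιinj` / `hιbtemp` for `ι = B^temp(−)|_{geom}`, relative temp-slimness `hZ`, surjectivity of `augG`,
continuity of `e` and a vertex of `𝔾`).  Every binder below is an inline hypothesis shape or producer datum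
named by its row; nothing is asserted.  Typed ≠ proved for the inputs; nothing here bears on [IUTchIII]
Cor. 3.12.
-/

namespace Literature.AnabelianGeometry.SemiGraphs

open _root_.CategoryTheory

universe u v w uG uH uV uB uV' uB'

variable {Obj : Type u} [Category.{v} Obj] {𝓥 : SemiAnbdVocab.{u, v, w} Obj}
variable {𝔊 ℍ : ArithSemiGraph 𝓥} {e : 𝔊.PA ≃* ℍ.PA}
variable {Gtp : Type uG} [Group Gtp] [TopologicalSpace Gtp]
variable {Htp : Type uH} [Group Htp] [TopologicalSpace Htp] [IsTopologicalGroup Htp] [T2Space Htp]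
variable {V : Type uV} {B : Type uB} {V' : Type uV'} {B' : Type uB'}
variable {D : DecompositionData Gtp V B} {D' : DecompositionData Htp V' B'}

/-- **[SemiAnbd] Theorem 5.4 (iii) from the sub-DAG rows, clause 3 discharged by row T54-7**:
`ArithQuasiGeometricCorrespondenceStatement 𝔊 ℍ e augG augH btemp` — (1) `B^temp(φ)` is arithmetically
quasi-geometric for every locally open `φ` over `A`; (2) `B^temp` is injective up to inner automorphism;
(3) every arithmetically quasi-geometric continuous `f` over `A` is a conjugate of some `B^temp(φ)` —
with (1) from Thm 5.4 (ii) + Rmk 5.3.1 on both sides and the containment / geometric-openness data of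
`B^temp(φ)` (`hIIG`, `hIIH`, `hRG`, `hRH`, `haugH`, `hcont`, `hover`, `hv`, `hb`), (2) from the injectivity
residual `hinj`, and (3) = `Thm54iii.clause3_of_geometric` fed by the geometric Cor 3.9 (b) at the kernels
(`hCor39`), the Prop 5.2 (iv) dictionary of `ι = B^temp(−)|_{geom}` (`hιG`, `hιH`, `hιinj`, `hιbtemp`),
relative temp-slimness (`hZ`), surjectivity of `augG`, continuity of `e` and a vertex of `𝔾`.
[cite: MochizukiSemiAnbd2006, Thm 5.4 (iii), p. 66] -/
theorem arithQuasiGeometricCorrespondenceStatement_of_geometric (augG : Gtp →* 𝔊.PA) (augH : Htp →* ℍ.PA)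
    (btemp : (φ : ArithHom 𝓥 𝔊 ℍ) → φ.IsLocallyOpen → ArithHom.IsOverA 𝔊 ℍ e φ → (Gtp →* Htp))
    (hIIG : ArithMaximalCompactStatementII D augG)
    (hIIH : ArithMaximalCompactStatementII D' (e.symm.toMonoidHom.comp augH))
    (hRG : VerticialEdgeLikeCompactAmpleStatement D augG)
    (hRH : VerticialEdgeLikeCompactAmpleStatement D' (e.symm.toMonoidHom.comp augH))
    (haugH : Continuous (e.symm.toMonoidHom.comp augH))
    (hcont : ∀ (φ : ArithHom 𝓥 𝔊 ℍ) (h₁ : φ.IsLocallyOpen) (h₂ : ArithHom.IsOverA 𝔊 ℍ e φ),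
      Continuous (btemp φ h₁ h₂))
    (hover : ∀ (φ : ArithHom 𝓥 𝔊 ℍ) (h₁ : φ.IsLocallyOpen) (h₂ : ArithHom.IsOverA 𝔊 ℍ e φ),
      (e.symm.toMonoidHom.comp augH).comp (btemp φ h₁ h₂) = augG)
    (hv : ∀ (φ : ArithHom 𝓥 𝔊 ℍ) (h₁ : φ.IsLocallyOpen) (h₂ : ArithHom.IsOverA 𝔊 ℍ e φ),
      ∃ f : V → V', ∀ v : V, ∃ g : Htp,
        (D.vertGp v).map (btemp φ h₁ h₂) ≤ conjSubgroup g (D'.vertGp (f v)) ∧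
          MapsOntoOpenSubgroupOf (btemp φ h₁ h₂) (D.vertGp v ⊓ augG.ker)
            (conjSubgroup g (D'.vertGp (f v)) ⊓ (e.symm.toMonoidHom.comp augH).ker))
    (hb : ∀ (φ : ArithHom 𝓥 𝔊 ℍ) (h₁ : φ.IsLocallyOpen) (h₂ : ArithHom.IsOverA 𝔊 ℍ e φ),
      ∃ fb : B → B', ∀ b : B, ∃ g : Htp,
        (D.brGp b).map (btemp φ h₁ h₂) ≤ conjSubgroup g (D'.brGp (fb b)) ∧
          MapsOntoOpenSubgroupOf (btemp φ h₁ h₂) (D.brGp b ⊓ augG.ker)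
            (conjSubgroup g (D'.brGp (fb b)) ⊓ (e.symm.toMonoidHom.comp augH).ker))
    (hinj : ∀ (φ ψ : ArithHom 𝓥 𝔊 ℍ) (h₁ : φ.IsLocallyOpen) (h₂ : ArithHom.IsOverA 𝔊 ℍ e φ)
      (k₁ : ψ.IsLocallyOpen) (k₂ : ArithHom.IsOverA 𝔊 ℍ e ψ),
      (∃ h : Htp, ∀ g : Gtp, btemp ψ k₁ k₂ g = h * btemp φ h₁ h₂ g * h⁻¹) → φ = ψ)
    (ι : (𝔊.G ⟶ ℍ.G) → (augG.ker →* Htp))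
    (hιG : ∀ (g : 𝔊.G ⟶ ℍ.G) (a : 𝔊.PA) (γ : Gtp), augG γ = a →
      ∃ δ ∈ (e.symm.toMonoidHom.comp augH).ker, ∀ x : augG.ker, ι ((𝔊.ρ a).hom ≫ g) x =
        δ * ι g ⟨γ * x * γ⁻¹, (MonoidHom.normal_ker augG).conj_mem _ x.2 γ⟩ * δ⁻¹)
    (hιH : ∀ (g : 𝔊.G ⟶ ℍ.G) (a : 𝔊.PA) (η : Htp), (e.symm.toMonoidHom.comp augH) η = a →
      ∃ δ ∈ (e.symm.toMonoidHom.comp augH).ker,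
        ∀ x : augG.ker, ι (g ≫ (ℍ.ρ (e a)).hom) x = δ * (η * ι g x * η⁻¹) * δ⁻¹)
    (hιinj : ∀ g₁ g₂ : 𝔊.G ⟶ ℍ.G,
      (∃ δ ∈ (e.symm.toMonoidHom.comp augH).ker, ∀ x : augG.ker, ι g₁ x = δ * ι g₂ x * δ⁻¹) →
        g₁ = g₂)
    (hιbtemp : ∀ (φ : ArithHom 𝓥 𝔊 ℍ) (h₁ : φ.IsLocallyOpen) (h₂ : ArithHom.IsOverA 𝔊 ℍ e φ),
      ∃ δ ∈ (e.symm.toMonoidHom.comp augH).ker,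
        ∀ x : augG.ker, btemp φ h₁ h₂ x = δ * ι φ.geom x * δ⁻¹)
    (hCor39 : ∀ f : Gtp →* Htp, Continuous f → (e.symm.toMonoidHom.comp augH).comp f = augG →
      (∀ v : V, ∃ (w : V') (x : Htp), MapsOntoOpenSubgroupOf f (D.vertGp v ⊓ augG.ker)
        (conjSubgroup x (D'.vertGp w) ⊓ (e.symm.toMonoidHom.comp augH).ker)) →
      (∀ b : B, ∃ (b' : B') (x : Htp), MapsOntoOpenSubgroupOf f (D.brGp b ⊓ augG.ker)
        (conjSubgroup x (D'.brGp b') ⊓ (e.symm.toMonoidHom.comp augH).ker)) →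
      ∃ (g : 𝔊.G ⟶ ℍ.G), ∃ h ∈ (e.symm.toMonoidHom.comp augH).ker,
        ∀ x : augG.ker, f x = h * ι g x * h⁻¹)
    (hZ : ∀ (w : V') (x : Htp) (U : Subgroup Htp),
      U ≤ conjSubgroup x (D'.vertGp w) ⊓ (e.symm.toMonoidHom.comp augH).ker →
      IsOpen ((Subtype.val :
          (conjSubgroup x (D'.vertGp w) ⊓ (e.symm.toMonoidHom.comp augH).ker : Subgroup Htp) → Htp) ⁻¹'
        (U : Set Htp)) →
      ∀ z ∈ (e.symm.toMonoidHom.comp augH).ker, (∀ u ∈ U, z * u = u * z) → z = 1)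
    (hsurjG : Function.Surjective augG) (he : Continuous e) (hV : Nonempty V) :
    Literature.AnabelianGeometry.SemiGraphs.ArithQuasiGeometricCorrespondenceStatement 𝔊 ℍ e augG augH btemp :=
  arithQuasiGeometricCorrespondenceStatement_of_rows augG augH btemp hIIG hIIH hRG hRH haugH hcont hover hv
    hb hinj
    (Thm54iii.clause3_of_geometric augG (e.symm.toMonoidHom.comp augH) btemp hIIG hIIH hover ι hιG hιH
      hιinj hιbtemp hCor39 hZ hsurjG he hV)

/-! ### Junction v2: clauses 2 and 3 both discharged (rows T54-6/T54-7, abc-iut-w5-d141) -/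

/-- **[SemiAnbd] Theorem 5.4 (iii) from the sub-DAG rows, clauses 2 AND 3 discharged**: as
`arithQuasiGeometricCorrespondenceStatement_of_geometric`, with (2) the injectivity residual `hinj` REPLACED
by `Thm54iii.hinj_of_geometric` (a conjugator between two homomorphisms over `A` is geometric by slimness of
`Π_A` = the field `𝔊.slim`; then Cor 3.9 injectivity of `ι = B^temp(−)|_{geom}` up to geometric inner
automorphisms) and (3) the relative temp-slimness input `hZ` REPLACED by its derivation
(`Thm54iii.clause3_of_geometric'` ∘ `relSlim_of_commensurator_slim`) from the commensurator description of
the verticial subgroups of `Π^temp_ℍ` (`hcommV'`, p. 65), their compactness (Rmk 5.3.1, `hRH`) and slimness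
of their geometric parts (`hslim`, Prop 5.2 (iii) / [SemiAnbd] Cor 2.7 (ii)) — the composite term is
abc-iut-w5-d141's kernel witness, filed here by the umbrella's one writer.  CONDITIONAL on exactly the
displayed inputs: Thm 5.4 (ii) + Rmk 5.3.1 on both sides, the `B^temp` data (`hcont`, `hover`, `hv`, `hb`),
the Prop 5.2 (iv) dictionary of `ι` (`hιG`, `hιH`, `hιinj`, `hιbtemp`), the geometric Cor 3.9 (b) at the
kernels (`hCor39`), `hcommV'`, `hslim`, surjectivity of `augG`, continuity of `e`, a vertex of `𝔾`.
[cite: MochizukiSemiAnbd2006, Thm 5.4 (iii), p. 66] -/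
theorem arithQuasiGeometricCorrespondenceStatement_of_geometric_of_slim (augG : Gtp →* 𝔊.PA) (augH : Htp →* ℍ.PA)
    (btemp : (φ : ArithHom 𝓥 𝔊 ℍ) → φ.IsLocallyOpen → ArithHom.IsOverA 𝔊 ℍ e φ → (Gtp →* Htp))
    (hIIG : ArithMaximalCompactStatementII D augG)
    (hIIH : ArithMaximalCompactStatementII D' (e.symm.toMonoidHom.comp augH))
    (hRG : VerticialEdgeLikeCompactAmpleStatement D augG)
    (hRH : VerticialEdgeLikeCompactAmpleStatement D' (e.symm.toMonoidHom.comp augH))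
    (haugH : Continuous (e.symm.toMonoidHom.comp augH))
    (hcont : ∀ (φ : ArithHom 𝓥 𝔊 ℍ) (h₁ : φ.IsLocallyOpen) (h₂ : ArithHom.IsOverA 𝔊 ℍ e φ),
      Continuous (btemp φ h₁ h₂))
    (hover : ∀ (φ : ArithHom 𝓥 𝔊 ℍ) (h₁ : φ.IsLocallyOpen) (h₂ : ArithHom.IsOverA 𝔊 ℍ e φ),
      (e.symm.toMonoidHom.comp augH).comp (btemp φ h₁ h₂) = augG)
    (hv : ∀ (φ : ArithHom 𝓥 𝔊 ℍ) (h₁ : φ.IsLocallyOpen) (h₂ : ArithHom.IsOverA 𝔊 ℍ e φ),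
      ∃ f : V → V', ∀ v : V, ∃ g : Htp,
        (D.vertGp v).map (btemp φ h₁ h₂) ≤ conjSubgroup g (D'.vertGp (f v)) ∧
          MapsOntoOpenSubgroupOf (btemp φ h₁ h₂) (D.vertGp v ⊓ augG.ker)
            (conjSubgroup g (D'.vertGp (f v)) ⊓ (e.symm.toMonoidHom.comp augH).ker))
    (hb : ∀ (φ : ArithHom 𝓥 𝔊 ℍ) (h₁ : φ.IsLocallyOpen) (h₂ : ArithHom.IsOverA 𝔊 ℍ e φ),
      ∃ fb : B → B', ∀ b : B, ∃ g : Htp,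
        (D.brGp b).map (btemp φ h₁ h₂) ≤ conjSubgroup g (D'.brGp (fb b)) ∧
          MapsOntoOpenSubgroupOf (btemp φ h₁ h₂) (D.brGp b ⊓ augG.ker)
            (conjSubgroup g (D'.brGp (fb b)) ⊓ (e.symm.toMonoidHom.comp augH).ker))
    (ι : (𝔊.G ⟶ ℍ.G) → (augG.ker →* Htp))
    (hιG : ∀ (g : 𝔊.G ⟶ ℍ.G) (a : 𝔊.PA) (γ : Gtp), augG γ = a →
      ∃ δ ∈ (e.symm.toMonoidHom.comp augH).ker, ∀ x : augG.ker, ι ((𝔊.ρ a).hom ≫ g) x =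
        δ * ι g ⟨γ * x * γ⁻¹, (MonoidHom.normal_ker augG).conj_mem _ x.2 γ⟩ * δ⁻¹)
    (hιH : ∀ (g : 𝔊.G ⟶ ℍ.G) (a : 𝔊.PA) (η : Htp), (e.symm.toMonoidHom.comp augH) η = a →
      ∃ δ ∈ (e.symm.toMonoidHom.comp augH).ker,
        ∀ x : augG.ker, ι (g ≫ (ℍ.ρ (e a)).hom) x = δ * (η * ι g x * η⁻¹) * δ⁻¹)
    (hιinj : ∀ g₁ g₂ : 𝔊.G ⟶ ℍ.G,
      (∃ δ ∈ (e.symm.toMonoidHom.comp augH).ker, ∀ x : augG.ker, ι g₁ x = δ * ι g₂ x * δ⁻¹) →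
        g₁ = g₂)
    (hιbtemp : ∀ (φ : ArithHom 𝓥 𝔊 ℍ) (h₁ : φ.IsLocallyOpen) (h₂ : ArithHom.IsOverA 𝔊 ℍ e φ),
      ∃ δ ∈ (e.symm.toMonoidHom.comp augH).ker,
        ∀ x : augG.ker, btemp φ h₁ h₂ x = δ * ι φ.geom x * δ⁻¹)
    (hCor39 : ∀ f : Gtp →* Htp, Continuous f → (e.symm.toMonoidHom.comp augH).comp f = augG →
      (∀ v : V, ∃ (w : V') (x : Htp), MapsOntoOpenSubgroupOf f (D.vertGp v ⊓ augG.ker)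
        (conjSubgroup x (D'.vertGp w) ⊓ (e.symm.toMonoidHom.comp augH).ker)) →
      (∀ b : B, ∃ (b' : B') (x : Htp), MapsOntoOpenSubgroupOf f (D.brGp b ⊓ augG.ker)
        (conjSubgroup x (D'.brGp b') ⊓ (e.symm.toMonoidHom.comp augH).ker)) →
      ∃ (g : 𝔊.G ⟶ ℍ.G), ∃ h ∈ (e.symm.toMonoidHom.comp augH).ker,
        ∀ x : augG.ker, f x = h * ι g x * h⁻¹)
    (hcommV' : ∀ w : V', Subgroup.Commensurable.commensurator
      (D'.vertGp w ⊓ (e.symm.toMonoidHom.comp augH).ker) = D'.vertGp w)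
    (hslim : ∀ (w : V') (x : Htp),
      Literature.AlgebraicGeometry.Frobenioids.IsSlimGroup (conjSubgroup x (D'.vertGp w) ⊓ (e.symm.toMonoidHom.comp augH).ker : Subgroup Htp))
    (hsurjG : Function.Surjective augG) (he : Continuous e) (hV : Nonempty V) :
    Literature.AnabelianGeometry.SemiGraphs.ArithQuasiGeometricCorrespondenceStatement 𝔊 ℍ e augG augH btemp :=
  arithQuasiGeometricCorrespondenceStatement_of_rows augG augH btemp hIIG hIIH hRG hRH haugH hcont hover hv
    hb
    (Thm54iii.hinj_of_geometric augG (e.symm.toMonoidHom.comp augH) btemp hover ι hιinj hιbtemp hsurjG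
      𝔊.slim)
    (Thm54iii.clause3_of_geometric' augG (e.symm.toMonoidHom.comp augH) btemp hIIG hIIH hRH haugH hcommV'
      hslim hover ι hιG hιH hιinj hιbtemp hCor39 hsurjG he hV)

/-! ### Junction v3: the per-`φ` binders `hv` / `hb` discharged from the datum `ι` (row T54-5b, abc-iut-w5-d141) -/

/-- **[SemiAnbd] Theorem 5.4 (iii) from the sub-DAG rows, clauses 2 AND 3 discharged and the clause-1
binders `hv` / `hb` produced from `ι`**: as `arithQuasiGeometricCorrespondenceStatement_of_geometric_of_slim`
(abc-iut-w4-d085, v2), with the containment-and-geometric-openness binders `hv` / `hb` of `B^temp(φ)` REPLACED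
by `Thm54iii.hv_of_iota` / `Thm54iii.hb_of_iota` (row T54-5b, abc-iut-w5-d141: the `ι`-level Prop 3.6 (iv) /
Thm 3.7 (iv) shapes `hιgeomV` / `hιgeomE` transported along `hιbtemp`, then abc-iut-w4-d106's adapter
`hv_of_geomOpen` / `hb_of_geomOpen` from the commensurator description of p. 65 on both sides — `hcommV`,
`hcommV'`, `hcommB`, `hcommB'` — Rmk 5.3.1 on the `ℍ`-side and continuity of `augH'`).  CONDITIONAL on exactly
the displayed inputs: Thm 5.4 (ii) on both sides (`hIIG`, `hIIH`), Rmk 5.3.1 on both sides (`hRG`, `hRH`), the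
producer data `haugH`, `hcont`, `hover`, the Prop 5.2 (iv) dictionary of `ι = B^temp(−)|_{geom}` (`hιG`, `hιH`,
`hιinj`, `hιbtemp`, `hιgeomV`, `hιgeomE`), the geometric Cor 3.9 (b) at the kernels (`hCor39`), the commensurator
descriptions (`hcommV`, `hcommV'`, `hcommB`, `hcommB'`), slimness of the geometric verticial parts (`hslim`),
surjectivity of `augG`, continuity of `e`, a vertex of `𝔾`.  Nothing asserted; no side on [IUTchIII] Cor 3.12.
[cite: MochizukiSemiAnbd2006, Thm 5.4 (iii), p. 66] -/
theorem arithQuasiGeometricCorrespondenceStatement_of_iota (augG : Gtp →* 𝔊.PA) (augH : Htp →* ℍ.PA)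
    (btemp : (φ : ArithHom 𝓥 𝔊 ℍ) → φ.IsLocallyOpen → ArithHom.IsOverA 𝔊 ℍ e φ → (Gtp →* Htp))
    (hIIG : ArithMaximalCompactStatementII D augG)
    (hIIH : ArithMaximalCompactStatementII D' (e.symm.toMonoidHom.comp augH))
    (hRG : VerticialEdgeLikeCompactAmpleStatement D augG)
    (hRH : VerticialEdgeLikeCompactAmpleStatement D' (e.symm.toMonoidHom.comp augH))
    (haugH : Continuous (e.symm.toMonoidHom.comp augH))
    (hcont : ∀ (φ : ArithHom 𝓥 𝔊 ℍ) (h₁ : φ.IsLocallyOpen) (h₂ : ArithHom.IsOverA 𝔊 ℍ e φ),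
      Continuous (btemp φ h₁ h₂))
    (hover : ∀ (φ : ArithHom 𝓥 𝔊 ℍ) (h₁ : φ.IsLocallyOpen) (h₂ : ArithHom.IsOverA 𝔊 ℍ e φ),
      (e.symm.toMonoidHom.comp augH).comp (btemp φ h₁ h₂) = augG)
    (ι : (𝔊.G ⟶ ℍ.G) → (augG.ker →* Htp))
    (hιG : ∀ (g : 𝔊.G ⟶ ℍ.G) (a : 𝔊.PA) (γ : Gtp), augG γ = a →
      ∃ δ ∈ (e.symm.toMonoidHom.comp augH).ker, ∀ x : augG.ker, ι ((𝔊.ρ a).hom ≫ g) x =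
        δ * ι g ⟨γ * x * γ⁻¹, (MonoidHom.normal_ker augG).conj_mem _ x.2 γ⟩ * δ⁻¹)
    (hιH : ∀ (g : 𝔊.G ⟶ ℍ.G) (a : 𝔊.PA) (η : Htp), (e.symm.toMonoidHom.comp augH) η = a →
      ∃ δ ∈ (e.symm.toMonoidHom.comp augH).ker,
        ∀ x : augG.ker, ι (g ≫ (ℍ.ρ (e a)).hom) x = δ * (η * ι g x * η⁻¹) * δ⁻¹)
    (hιinj : ∀ g₁ g₂ : 𝔊.G ⟶ ℍ.G,
      (∃ δ ∈ (e.symm.toMonoidHom.comp augH).ker, ∀ x : augG.ker, ι g₁ x = δ * ι g₂ x * δ⁻¹) →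
        g₁ = g₂)
    (hιbtemp : ∀ (φ : ArithHom 𝓥 𝔊 ℍ) (h₁ : φ.IsLocallyOpen) (h₂ : ArithHom.IsOverA 𝔊 ℍ e φ),
      ∃ δ ∈ (e.symm.toMonoidHom.comp augH).ker,
        ∀ x : augG.ker, btemp φ h₁ h₂ x = δ * ι φ.geom x * δ⁻¹)
    (hιgeomV : ∀ g : 𝔊.G ⟶ ℍ.G, ∃ fv : V → V', ∀ v : V, ∃ x : Htp,
      ((D.vertGp v ⊓ augG.ker).subgroupOf augG.ker).map (ι g) ≤
          conjSubgroup x (D'.vertGp (fv v)) ⊓ (e.symm.toMonoidHom.comp augH).ker ∧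
        IsOpen ((Subtype.val :
            (conjSubgroup x (D'.vertGp (fv v)) ⊓ (e.symm.toMonoidHom.comp augH).ker : Subgroup Htp) → Htp) ⁻¹'
          (((D.vertGp v ⊓ augG.ker).subgroupOf augG.ker).map (ι g) : Set Htp)))
    (hιgeomE : ∀ g : 𝔊.G ⟶ ℍ.G, ∃ fb : B → B', ∀ b : B, ∃ x : Htp,
      ((D.brGp b ⊓ augG.ker).subgroupOf augG.ker).map (ι g) ≤
          conjSubgroup x (D'.brGp (fb b)) ⊓ (e.symm.toMonoidHom.comp augH).ker ∧
        IsOpen ((Subtype.val :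
            (conjSubgroup x (D'.brGp (fb b)) ⊓ (e.symm.toMonoidHom.comp augH).ker : Subgroup Htp) → Htp) ⁻¹'
          (((D.brGp b ⊓ augG.ker).subgroupOf augG.ker).map (ι g) : Set Htp)))
    (hCor39 : ∀ f : Gtp →* Htp, Continuous f → (e.symm.toMonoidHom.comp augH).comp f = augG →
      (∀ v : V, ∃ (w : V') (x : Htp), MapsOntoOpenSubgroupOf f (D.vertGp v ⊓ augG.ker)
        (conjSubgroup x (D'.vertGp w) ⊓ (e.symm.toMonoidHom.comp augH).ker)) →
      (∀ b : B, ∃ (b' : B') (x : Htp), MapsOntoOpenSubgroupOf f (D.brGp b ⊓ augG.ker)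
        (conjSubgroup x (D'.brGp b') ⊓ (e.symm.toMonoidHom.comp augH).ker)) →
      ∃ (g : 𝔊.G ⟶ ℍ.G), ∃ h ∈ (e.symm.toMonoidHom.comp augH).ker,
        ∀ x : augG.ker, f x = h * ι g x * h⁻¹)
    (hcommV : ∀ v : V, Subgroup.Commensurable.commensurator (D.vertGp v ⊓ augG.ker) = D.vertGp v)
    (hcommV' : ∀ w : V', Subgroup.Commensurable.commensurator
      (D'.vertGp w ⊓ (e.symm.toMonoidHom.comp augH).ker) = D'.vertGp w)
    (hcommB : ∀ b : B, Subgroup.Commensurable.commensurator (D.brGp b ⊓ augG.ker) = D.brGp b)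
    (hcommB' : ∀ b' : B', Subgroup.Commensurable.commensurator
      (D'.brGp b' ⊓ (e.symm.toMonoidHom.comp augH).ker) = D'.brGp b')
    (hslim : ∀ (w : V') (x : Htp),
      Literature.AlgebraicGeometry.Frobenioids.IsSlimGroup (conjSubgroup x (D'.vertGp w) ⊓ (e.symm.toMonoidHom.comp augH).ker : Subgroup Htp))
    (hsurjG : Function.Surjective augG) (he : Continuous e) (hV : Nonempty V) :
    Literature.AnabelianGeometry.SemiGraphs.ArithQuasiGeometricCorrespondenceStatement 𝔊 ℍ e augG augH btemp :=
  arithQuasiGeometricCorrespondenceStatement_of_geometric_of_slim augG augH btemp hIIG hIIH hRG hRH haugH hcont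
    hover
    (Thm54iii.hv_of_iota augG (e.symm.toMonoidHom.comp augH) btemp haugH hRH hcommV hcommV' ι hιbtemp hιgeomV)
    (Thm54iii.hb_of_iota augG (e.symm.toMonoidHom.comp augH) btemp haugH hRH hcommB hcommB' ι hιbtemp hιgeomE)
    ι hιG hιH hιinj hιbtemp hCor39 hcommV' hslim hsurjG he hV

/-! ### Junction v3b: the COMPATIBLE reading of Thm 5.4 (iii) (χ2 twin; clause 3 re-glued through `hCor39c`, abc-iut-w5-d141) -/

/-- **[SemiAnbd] Theorem 5.4 (iii), COMPATIBLE reading, from the sub-DAG rows** — abc-iut-w4-d083's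
`ArithQuasiGeometricCorrespondenceStatementCompat 𝔊 ℍ e augG augH btemp` (clauses 1 and 3 with "arithmetically
quasi-geometric" read compatibly, clause 2 verbatim): clause 1 = the literal clause 1 exactly as in
`arithQuasiGeometricCorrespondenceStatement_of_iota` (Thm 5.4 (ii) + Rmk 5.3.1 on both sides, `hv`/`hb` produced
from `ι` by `Thm54iii.hv_of_iota` / `hb_of_iota`) TOGETHER WITH the compatibility clause for `B^temp(φ)` taken as
ONE honest binder `h1c` (the arithmetic R0′ — a producer datum: `B^temp(φ)` carries the decomposition groups of
adjacent vertices of the universal pro-tree to those of the two DISTINCT end-points of the image edge; NOT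
derivable from per-vertex / per-branch shadows, cf. the fold); clause 2 = `Thm54iii.innerEquiv_iff_exists_conj_of_injective`
(abc-iut-w4-d082) fed by `Thm54iii.hinj_of_geometric`; clause 3 = `Thm54iii.clause3Compat_of_geometric'` (row
T54-7 re-glued, finding W4d083-F2): from the COMPATIBLE geometric Cor 3.9 (b) at the kernels `hCor39c`
(F2-SHAPES (R2) text verbatim — discharged at the producer's junction by abc-iut-w4-d083's
`ProfiniteSemiGraph.isCompatiblyQuasiGeometric_of_shadows` + abc-iut-w4-d080's
`exists_hom_chartPullbackWith_iso_of_isCompatiblyQuasiGeometric(At)` + Prop 3.6 (iv) unfolding) and the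
`𝔊`-side shadow `hadj` of the geometric Thm 3.7 (iii).  The literal binder `hCor39` is GONE.  CONDITIONAL on
exactly the displayed inputs; nothing asserted; no side on [IUTchIII] Cor 3.12.
[cite: MochizukiSemiAnbd2006, Thm 5.4 (iii), p. 66] -/
theorem arithQuasiGeometricCorrespondenceStatementCompat_of_iota (augG : Gtp →* 𝔊.PA) (augH : Htp →* ℍ.PA)
    (btemp : (φ : ArithHom 𝓥 𝔊 ℍ) → φ.IsLocallyOpen → ArithHom.IsOverA 𝔊 ℍ e φ → (Gtp →* Htp))
    (hIIG : ArithMaximalCompactStatementII D augG)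
    (hIIH : ArithMaximalCompactStatementII D' (e.symm.toMonoidHom.comp augH))
    (hRG : VerticialEdgeLikeCompactAmpleStatement D augG)
    (hRH : VerticialEdgeLikeCompactAmpleStatement D' (e.symm.toMonoidHom.comp augH))
    (haugH : Continuous (e.symm.toMonoidHom.comp augH))
    (hcont : ∀ (φ : ArithHom 𝓥 𝔊 ℍ) (h₁ : φ.IsLocallyOpen) (h₂ : ArithHom.IsOverA 𝔊 ℍ e φ),
      Continuous (btemp φ h₁ h₂))
    (hover : ∀ (φ : ArithHom 𝓥 𝔊 ℍ) (h₁ : φ.IsLocallyOpen) (h₂ : ArithHom.IsOverA 𝔊 ℍ e φ),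
      (e.symm.toMonoidHom.comp augH).comp (btemp φ h₁ h₂) = augG)
    (h1c : ∀ (φ : ArithHom 𝓥 𝔊 ℍ) (h₁ : φ.IsLocallyOpen) (h₂ : ArithHom.IsOverA 𝔊 ℍ e φ),
      ∀ K₁ H₁ : Subgroup Gtp, IsArithMaximalCompact augG K₁ → IsArithMaximalCompact augG H₁ →
        K₁ ≠ H₁ → IsArithAmple augG (K₁ ⊓ H₁) →
          ∃ K₂ H₂ : Subgroup Htp, IsArithMaximalCompact (e.symm.toMonoidHom.comp augH) K₂ ∧
            IsArithMaximalCompact (e.symm.toMonoidHom.comp augH) H₂ ∧ K₂ ≠ H₂ ∧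
              K₁.map (btemp φ h₁ h₂) ≤ K₂ ∧ H₁.map (btemp φ h₁ h₂) ≤ H₂)
    (ι : (𝔊.G ⟶ ℍ.G) → (augG.ker →* Htp))
    (hιG : ∀ (g : 𝔊.G ⟶ ℍ.G) (a : 𝔊.PA) (γ : Gtp), augG γ = a →
      ∃ δ ∈ (e.symm.toMonoidHom.comp augH).ker, ∀ x : augG.ker, ι ((𝔊.ρ a).hom ≫ g) x =
        δ * ι g ⟨γ * x * γ⁻¹, (MonoidHom.normal_ker augG).conj_mem _ x.2 γ⟩ * δ⁻¹)
    (hιH : ∀ (g : 𝔊.G ⟶ ℍ.G) (a : 𝔊.PA) (η : Htp), (e.symm.toMonoidHom.comp augH) η = a →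
      ∃ δ ∈ (e.symm.toMonoidHom.comp augH).ker,
        ∀ x : augG.ker, ι (g ≫ (ℍ.ρ (e a)).hom) x = δ * (η * ι g x * η⁻¹) * δ⁻¹)
    (hιinj : ∀ g₁ g₂ : 𝔊.G ⟶ ℍ.G,
      (∃ δ ∈ (e.symm.toMonoidHom.comp augH).ker, ∀ x : augG.ker, ι g₁ x = δ * ι g₂ x * δ⁻¹) →
        g₁ = g₂)
    (hιbtemp : ∀ (φ : ArithHom 𝓥 𝔊 ℍ) (h₁ : φ.IsLocallyOpen) (h₂ : ArithHom.IsOverA 𝔊 ℍ e φ),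
      ∃ δ ∈ (e.symm.toMonoidHom.comp augH).ker,
        ∀ x : augG.ker, btemp φ h₁ h₂ x = δ * ι φ.geom x * δ⁻¹)
    (hιgeomV : ∀ g : 𝔊.G ⟶ ℍ.G, ∃ fv : V → V', ∀ v : V, ∃ x : Htp,
      ((D.vertGp v ⊓ augG.ker).subgroupOf augG.ker).map (ι g) ≤
          conjSubgroup x (D'.vertGp (fv v)) ⊓ (e.symm.toMonoidHom.comp augH).ker ∧
        IsOpen ((Subtype.val :
            (conjSubgroup x (D'.vertGp (fv v)) ⊓ (e.symm.toMonoidHom.comp augH).ker : Subgroup Htp) → Htp) ⁻¹'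
          (((D.vertGp v ⊓ augG.ker).subgroupOf augG.ker).map (ι g) : Set Htp)))
    (hιgeomE : ∀ g : 𝔊.G ⟶ ℍ.G, ∃ fb : B → B', ∀ b : B, ∃ x : Htp,
      ((D.brGp b ⊓ augG.ker).subgroupOf augG.ker).map (ι g) ≤
          conjSubgroup x (D'.brGp (fb b)) ⊓ (e.symm.toMonoidHom.comp augH).ker ∧
        IsOpen ((Subtype.val :
            (conjSubgroup x (D'.brGp (fb b)) ⊓ (e.symm.toMonoidHom.comp augH).ker : Subgroup Htp) → Htp) ⁻¹'
          (((D.brGp b ⊓ augG.ker).subgroupOf augG.ker).map (ι g) : Set Htp)))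
    (hCor39c : ∀ f : Gtp →* Htp, Continuous f → (e.symm.toMonoidHom.comp augH).comp f = augG →
      (∀ v : V, ∃ (w : V') (x : Htp), MapsOntoOpenSubgroupOf f (D.vertGp v ⊓ augG.ker)
        (conjSubgroup x (D'.vertGp w) ⊓ (e.symm.toMonoidHom.comp augH).ker)) →
      (∀ b : B, ∃ (b' : B') (x : Htp), MapsOntoOpenSubgroupOf f (D.brGp b ⊓ augG.ker)
        (conjSubgroup x (D'.brGp b') ⊓ (e.symm.toMonoidHom.comp augH).ker)) →
      (∀ (v₁ v₂ : V) (γ₁ γ₂ : Gtp),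
        conjSubgroup γ₁ (D.vertGp v₁) ⊓ augG.ker ≠ conjSubgroup γ₂ (D.vertGp v₂) ⊓ augG.ker →
        conjSubgroup γ₁ (D.vertGp v₁) ⊓ conjSubgroup γ₂ (D.vertGp v₂) ⊓ augG.ker ≠ ⊥ →
          ∃ (w₁ w₂ : V') (x₁ x₂ : Htp),
            conjSubgroup x₁ (D'.vertGp w₁) ⊓ (e.symm.toMonoidHom.comp augH).ker ≠
                conjSubgroup x₂ (D'.vertGp w₂) ⊓ (e.symm.toMonoidHom.comp augH).ker ∧
              (conjSubgroup γ₁ (D.vertGp v₁) ⊓ augG.ker).map f ≤ conjSubgroup x₁ (D'.vertGp w₁) ∧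
                (conjSubgroup γ₂ (D.vertGp v₂) ⊓ augG.ker).map f ≤ conjSubgroup x₂ (D'.vertGp w₂)) →
      ∃ (g : 𝔊.G ⟶ ℍ.G), ∃ h ∈ (e.symm.toMonoidHom.comp augH).ker,
        ∀ x : augG.ker, f x = h * ι g x * h⁻¹)
    (hadj : ∀ (v₁ v₂ : V) (γ₁ γ₂ : Gtp),
      conjSubgroup γ₁ (D.vertGp v₁) ⊓ augG.ker ≠ conjSubgroup γ₂ (D.vertGp v₂) ⊓ augG.ker →
      conjSubgroup γ₁ (D.vertGp v₁) ⊓ conjSubgroup γ₂ (D.vertGp v₂) ⊓ augG.ker ≠ ⊥ →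
        ∃ E : Subgroup Gtp, IsEdgeLike D E ∧ E ≤ conjSubgroup γ₁ (D.vertGp v₁) ⊓ conjSubgroup γ₂ (D.vertGp v₂))
    (hcommV : ∀ v : V, Subgroup.Commensurable.commensurator (D.vertGp v ⊓ augG.ker) = D.vertGp v)
    (hcommV' : ∀ w : V', Subgroup.Commensurable.commensurator
      (D'.vertGp w ⊓ (e.symm.toMonoidHom.comp augH).ker) = D'.vertGp w)
    (hcommB : ∀ b : B, Subgroup.Commensurable.commensurator (D.brGp b ⊓ augG.ker) = D.brGp b)
    (hcommB' : ∀ b' : B', Subgroup.Commensurable.commensurator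
      (D'.brGp b' ⊓ (e.symm.toMonoidHom.comp augH).ker) = D'.brGp b')
    (hslim : ∀ (w : V') (x : Htp),
      Literature.AlgebraicGeometry.Frobenioids.IsSlimGroup (conjSubgroup x (D'.vertGp w) ⊓ (e.symm.toMonoidHom.comp augH).ker : Subgroup Htp))
    (hsurjG : Function.Surjective augG) (he : Continuous e) (hV : Nonempty V) :
    Literature.AnabelianGeometry.SemiGraphs.ArithQuasiGeometricCorrespondenceStatementCompat 𝔊 ℍ e augG augH
      btemp := by
  refine (arithQuasiGeometricCorrespondenceStatementCompat_iff 𝔊 ℍ e augG augH btemp).mpr ⟨?_, ?_, ?_⟩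
  · -- clause 1: the literal clause (Thm 5.4 (ii) + Rmk 5.3.1 + `hv`/`hb` from `ι`) and the compatibility clause `h1c`
    intro φ h₁ h₂
    refine (isArithCompatiblyQuasiGeometric_iff _ _ _).mpr ⟨?_, h1c φ h₁ h₂⟩
    obtain ⟨f, hf⟩ := Thm54iii.hv_of_iota augG (e.symm.toMonoidHom.comp augH) btemp haugH hRH hcommV hcommV' ι
      hιbtemp hιgeomV φ h₁ h₂
    obtain ⟨fb, hfb⟩ := Thm54iii.hb_of_iota augG (e.symm.toMonoidHom.comp augH) btemp haugH hRH hcommB hcommB'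
      ι hιbtemp hιgeomE φ h₁ h₂
    exact isArithQuasiGeometric_of_statementII hIIG hIIH (hcont φ h₁ h₂) (hover φ h₁ h₂)
      (hV_of_compat haugH (hcont φ h₁ h₂) (hover φ h₁ h₂) hRG hRH f hf)
      (hE_of_compat haugH (hcont φ h₁ h₂) (hover φ h₁ h₂) hRG hRH fb hfb)
  · -- clause 2: forward half unconditional, backward half = injectivity (`hinj_of_geometric`)
    exact Thm54iii.innerEquiv_iff_exists_conj_of_injective btemp
      (Thm54iii.hinj_of_geometric augG (e.symm.toMonoidHom.comp augH) btemp hover ι hιinj hιbtemp hsurjG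
        𝔊.slim)
  · -- clause 3, compatible reading: `clause3Compat_of_geometric'` through `hCor39c`
    intro f hf
    have hf' := (isArithCompatiblyQuasiGeometric_iff _ _ _).mp hf
    exact Thm54iii.clause3Compat_of_geometric' augG (e.symm.toMonoidHom.comp augH) btemp hIIG hIIH hRG hRH
      haugH hcommV' hslim hadj hover ι hιG hιH hιinj hιbtemp hCor39c hsurjG he hV f hf'.1 hf'.2

end Literature.AnabelianGeometry.SemiGraphs
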